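import Summits.BirchSwinnertonDyer.BirchSwinnertonDyer.Theorems.CMKolyvaginAtInertTwoLowerLevelTwoConditionAtTwo
import Summits.BirchSwinnertonDyer.BirchSwinnertonDyer.Theorems.CMKolyvaginAtInertTwoLowerLevelTwoAuxiliaryAtTwo
import Summits.BirchSwinnertonDyer.BirchSwinnertonDyer.Theorems.GenusKolyvaginAtTwoPowDvdShaCardAtTwoRTBottomRungEngine
import Summits.BirchSwinnertonDyer.BirchSwinnertonDyer.Theorems.CMKolyvaginAtInertTwoRationalDescentAtTwoPrimeDiscr
import Summits.BirchSwinnertonDyer.BirchSwinnertonDyer.Theorems.CMKolyvaginAtInertTwoRationalDescentAtTwoTower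
import HarnessLib

/-!
# Route `CMKolyvaginAtInertTwo`, crux `CMKolyvaginExactAtInertTwo` (stmt-BirchSwinnertonDyer-24277), `stub_lower` — W-UP on H₂,
# FILE W3a: THE AUXILIARY CLASS AND THE RECIPROCITY OF THE LEVEL-`2` ENGINE (McCallum's prime swap over `ℚ` at level `2`,
# all own primes GROSS; the engine itself is file W3b `…LowerLevelTwoEngineAtTwo`)

Seat `bsd-line-cmk2-p1` g19 (cell `bsd-print-cf2`), `--supports stmt-BirchSwinnertonDyer-24277` (helper; closes nothing).
THEOREMS ONLY (no definition, no named fact, no `sorry`).  BSD is NOT proved by any of this; the crux is not closed here.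

WHY (gk2 LEAD g16 memo `Cruxes/PowDvdShaCardAtTwoRT/Lines/plus-descent-lead-g16.md` §3; gk2-p5 `…/plus-descent-wup2-gk2p5.md` §6;
this seat's KERNEL-STATUS §19).  The residual of `stub_lower` is the upgrade of a SHALLOW certificate (`P(n) ∉ 2E(K[n])`, own primes
Gross of index `≥ 1`) to a level-`4` Gross witness.  Run McCallum's swap at LEVEL `2` over `ℚ`: for the `k`-minimal primitive product
`n` (fewest shallow own primes `s ≠ ∅`; deep own primes `t`; genus place `u` of the prime `|d_K|`), the descended class
`b = desc c₁(n) ∈ H¹(ℚ, E[2])` is Kummer off `s ∪ {u} ∪ t`, ZERO on `s` (minimality + Q2) and TRANSVERSE on `t` (Howard, margin one);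
by file W2 (Wiles' count, `#H¹(ℚ_u, E[2]) = 4 ≤ 4^{#s}`) there is an auxiliary `y ≠ 0`, Kummer off `s ∪ {u} ∪ t`, ZERO at `u`, in
file W1's condition `M_ℓ = loc(𝒯)^⊥` on `t`.  For a deep Čebotarev prime `ℓ′` of `(c₁(n), res_K y)` and `Z = desc c₁(nℓ′)` the
Poitou–Tate sum `Σ_v inv_v(loc_v Z ∪ loc_v y) = 0` has vanishing terms off `ℓ′` (Kummer ⊥ Kummer; `y_u = 0`; `Z_s = 0` by the
imprimitivity of the swaps + Q2 + gk2-p3's dictionary; `M_ℓ ⊥ loc(𝒯)` on `t`), while the `ℓ′`-term is NON-zero (Q2 at `λ′` makes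
`res Z` non-Selmer, the Čebotarev clause makes `loc y` generate the order-`2` Kummer line, which is Lagrangian): contradiction.
NO doubling `X = 2Z` (level `2`), hence the genus place must be killed by `y_u = 0` and the Kummer membership of `Z` over `ℚ`
needs the descent plumbing (desc-fin) — displayed as the hypothesis `hdesc` (discharged on H₂ with prime `|d_K|` by ty2's
`RationalDescentPlumbing.hdescfin_of_heegner_prime_discr`) — and the archimedean vanishing `H¹(ℝ, E[2])`-condition (g8's
`KolyvaginRatDescentTwo.mem_selmerLocalKer_infinitePlace_of_Δ_neg`, `Δ < 0`).
* §1 `exists_auxiliary_levelTwo` (W1 + W2), §2 `invWeilPairing_eq_zero_of_levelTwo_of_vanishing` (the reciprocity with the `s`-,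
  genus- and `t`-terms in vanishing form), §3 `exists_auxiliary_levelTwo_rec` (§4–§5, the local inputs and the engine: file W3b).

References: [McCallumLMS1991] §4 Prop. 4.4, §5 Lemma 5.3 and proof of Prop. 5.2; [GrossLMS1991] Prop. 6.2, §9; [MilneADT2006] I Thm. 4.10;
[Kramer1981] Prop. 3.
-/

set_option autoImplicit false
-- the Theorems namespace of this sub repeats the summit name by design (D-0017 nested layout)
set_option linter.dupNamespace false

noncomputable section

open scoped Classical

open Field NumberField IsDedekindDomain Function WeierstrassCurve
open Literature.NumberTheory.EllipticCurves
open Literature.NumberTheory.GaloisRepresentations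
open Literature.NumberTheory.GaloisCohomology
open Summit.BirchSwinnertonDyer.Rank1Residual.X11b.KummerPT
open Summit.BirchSwinnertonDyer.Rank1Residual.X11b.FiniteDuality
open Summit.BirchSwinnertonDyer.Rank1Residual.X11b.Relaxation

namespace Summit.BirchSwinnertonDyer.BirchSwinnertonDyer.Theorems.KolyvaginLowerTwo

open Summit.BirchSwinnertonDyer.BirchSwinnertonDyer.Theorems.GenusExact
open Summit.BirchSwinnertonDyer.BirchSwinnertonDyer.Theorems.GenusExact.SelmerDescent
open Summit.BirchSwinnertonDyer.BirchSwinnertonDyer.Theorems.GenusExact.DeepOwnPrime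
open Summit.BirchSwinnertonDyer.BirchSwinnertonDyer.Theorems.GenusExact.RelaxedCount
open Summit.BirchSwinnertonDyer.BirchSwinnertonDyer.Theorems.SchneiderFreeAdditiveX3.PoitouTateReduction

/-! ## §1 The auxiliary class: W1's conditions at the deep own primes fed into W2's count -/

section Auxiliary

variable (W : WeierstrassCurve ℚ) [W.IsElliptic] [W.IsGloballyMinimal]
variable (e : geomTorsion W ((2 ^ 1 : ℕ) : ℤ) → geomTorsion W ((2 ^ 1 : ℕ) : ℤ) → AlgebraicClosure ℚ)
  (hμ : ∀ S T, e S T ^ (2 ^ 1) = 1)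
  (hadd₁ : ∀ S₁ S₂ T, e (S₁ + S₂) T = e S₁ T * e S₂ T)
  (hadd₂ : ∀ S T₁ T₂, e S (T₁ + T₂) = e S T₁ * e S T₂)
  (hgal : ∀ (σ : absoluteGaloisGroup ℚ) (S T : geomTorsion W ((2 ^ 1 : ℕ) : ℤ)), σ • e S T = e (σ • S) (σ • T))
  (halt : ∀ T, e T T = 1) (hnondeg : ∀ T, (∀ S, e S T = 1) → T = 0)

include halt hnondeg in
/-- **The level-2 auxiliary with deep orthogonality.**  `E/ℚ` globally minimal, `Δ < 0`; `s`, `D`, `t` pairwise disjoint finite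
sets of places, `s ∪ t` at Gross–Kolyvagin primes (index `≥ 1`, `Frob_ℓ = Frob_∞` on `E[2]`); `∏_{u∈D} #H¹(ℚ_u, E[2]) ≤ 4^{#s}`; a class
`b ≠ 0` Kummer off `s ∪ D ∪ t`, ZERO on `s` and TRANSVERSE at the places of `t` (gk2-p3's `∀ 𝔓 ∀ F ∀ c₀` form).  Then there is
`y ≠ 0`, Kummer off `s ∪ D ∪ t`, ZERO on `D`, such that at every place of `t` and for every global `Z` transverse there
`inv_v(loc_v Z ∪ₑ loc_v y) = 0` (canonical family). [cite: McCallumLMS1991, §2 Prop. 2.1 and §5 proof of Prop. 5.2]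
[cite: MilneADT2006, Ch. I, Thm. 4.10] [cite: Kramer1981, Prop. 3] -/
theorem exists_auxiliary_levelTwo (hΔ : W.Δ < 0) {K : Type} [Field K] [NumberField K]
    (s D t : Finset (Place ℚ)) (hsD : Disjoint s D) (hst : Disjoint s t) (hDt : Disjoint D t)
    (hsK : ∀ u ∈ s ∪ t, ∃ (v : HeightOneSpectrum (𝓞 ℚ)) (ℓ : ℕ) (_ : Fact ℓ.Prime), u = Sum.inr v ∧ ℓ ≠ 2 ∧ (ℓ : 𝓞 ℚ) ∈ v.asIdeal ∧
      W.HasGoodReductionAtPrime ℓ ∧ FrobEqFrobInfty W K 2 ℓ ∧ 1 ≤ Zhang2014.kolyvaginIndex W 2 ℓ)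
    (hδ : ∏ u ∈ D, Nat.card (galoisCohomology ((W.torsionGaloisModule ((2 ^ 1 : ℕ) : ℤ)).toLocal u) 1) ≤ 4 ^ s.card)
    {b : galoisCohomology (W.torsionGaloisModule ((2 ^ 1 : ℕ) : ℤ)) 1} (hbT : b ∈ kummerOutside W (2 ^ 1) (s ∪ D ∪ t))
    (hbS : ∀ u ∈ s, galoisCohomology.localization (W.torsionGaloisModule ((2 ^ 1 : ℕ) : ℤ)) u 1 b = 0)
    (hbt : ∀ v : HeightOneSpectrum (𝓞 ℚ), Sum.inr v ∈ t →
      ∀ 𝔓 ∈ v.primesAbove, ∀ F c₀ : absoluteGaloisGroup ℚ, IsArithFrobAt (𝓞 ℚ) F 𝔓 →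
        IsComplexConjugation (Rat.castHom ℝ) c₀ → (∀ P : geomTorsion W ((2 ^ 1 : ℕ) : ℤ), F • P = c₀ • P) →
        ∃ P₁ : geomTorsion W ((2 ^ 1 : ℕ) : ℤ), h1Eval W _ b F = F • P₁ - P₁)
    (hb : b ≠ 0) :
    ∃ y ∈ kummerOutside W (2 ^ 1) (s ∪ D ∪ t), y ≠ 0 ∧
      (∀ u ∈ D, galoisCohomology.localization (W.torsionGaloisModule ((2 ^ 1 : ℕ) : ℤ)) u 1 y = 0) ∧
      ∀ v : HeightOneSpectrum (𝓞 ℚ), Sum.inr v ∈ t →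
        ∀ Z : galoisCohomology (W.torsionGaloisModule ((2 ^ 1 : ℕ) : ℤ)) 1,
          (∀ 𝔓 ∈ v.primesAbove, ∀ F c₀ : absoluteGaloisGroup ℚ, IsArithFrobAt (𝓞 ℚ) F 𝔓 →
            IsComplexConjugation (Rat.castHom ℝ) c₀ → (∀ P : geomTorsion W ((2 ^ 1 : ℕ) : ℤ), F • P = c₀ • P) →
            ∃ P₁ : geomTorsion W ((2 ^ 1 : ℕ) : ℤ), h1Eval W _ Z F = F • P₁ - P₁) →
          invWeilPairing W (2 ^ 1) e hμ hadd₁ hadd₂ hgal (LocalInvariants.canonical ℚ (2 ^ 1)) (Sum.inr v)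
            (galoisCohomology.localization (W.torsionGaloisModule ((2 ^ 1 : ℕ) : ℤ)) (Sum.inr v) 1 Z)
            (galoisCohomology.localization (W.torsionGaloisModule ((2 ^ 1 : ℕ) : ℤ)) (Sum.inr v) 1 y) = 0 := by
  have hperf := LocalInvariants.canonical_isPerfect (K := ℚ) (n := 2 ^ 1)
  -- Step 1: a local condition at every place (W1 at the places of `t`, `⊥` elsewhere)
  have key : ∀ u : Place ℚ, ∃ M : AddSubgroup (galoisCohomology ((W.torsionGaloisModule ((2 ^ 1 : ℕ) : ℤ)).toLocal u) 1),
      u ∈ t → (2 ≤ Nat.card M ∧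
        ∀ v : HeightOneSpectrum (𝓞 ℚ), u = Sum.inr v →
          ∀ Z : galoisCohomology (W.torsionGaloisModule ((2 ^ 1 : ℕ) : ℤ)) 1,
            (∀ 𝔓 ∈ v.primesAbove, ∀ F c₀ : absoluteGaloisGroup ℚ, IsArithFrobAt (𝓞 ℚ) F 𝔓 →
              IsComplexConjugation (Rat.castHom ℝ) c₀ → (∀ P : geomTorsion W ((2 ^ 1 : ℕ) : ℤ), F • P = c₀ • P) →
              ∃ P₁ : geomTorsion W ((2 ^ 1 : ℕ) : ℤ), h1Eval W _ Z F = F • P₁ - P₁) →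
            (∀ m ∈ M, invWeilPairing W (2 ^ 1) e hμ hadd₁ hadd₂ hgal (LocalInvariants.canonical ℚ (2 ^ 1)) u
              (galoisCohomology.localization (W.torsionGaloisModule ((2 ^ 1 : ℕ) : ℤ)) u 1 Z) m = 0) ∧
            galoisCohomology.localization (W.torsionGaloisModule ((2 ^ 1 : ℕ) : ℤ)) u 1 Z ∈
              annLeft (invWeilPairing W (2 ^ 1) e hμ hadd₁ hadd₂ hgal (LocalInvariants.canonical ℚ (2 ^ 1)) u) M) := by
    intro u
    by_cases hut : u ∈ t
    · obtain ⟨v, ℓ, hℓp, hu, hℓ2, hv, hgood, hFrob, hidx⟩ := hsK u (Finset.mem_union_right s hut)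
      subst hu
      obtain ⟨M, hM2, hM⟩ := exists_localCondition_two_le_rat W e hμ hadd₁ hadd₂ hgal halt hnondeg
        (LocalInvariants.canonical ℚ (2 ^ 1)) hΔ hℓ2 hgood hFrob hv hidx (hperf v).1.1
      refine ⟨M, fun _ ↦ ⟨hM2, fun v' hv' Z hZ ↦ ?_⟩⟩
      have hvv' : v = v' := Sum.inr_injective hv'
      subst hvv'
      exact hM Z hZ
    · exact ⟨⊥, fun h ↦ (hut h).elim⟩
  choose Mt hMt using key
  -- Step 2: the dual element `b` lies in W1's annihilators at the places of `t`
  have hbt' : ∀ u ∈ t, galoisCohomology.localization (W.torsionGaloisModule ((2 ^ 1 : ℕ) : ℤ)) u 1 b ∈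
      annLeft (invWeilPairing W (2 ^ 1) e hμ hadd₁ hadd₂ hgal (LocalInvariants.canonical ℚ (2 ^ 1)) u) (Mt u) := by
    intro u hut
    obtain ⟨v, ℓ, hℓp, hu, -⟩ := hsK u (Finset.mem_union_right s hut)
    subst hu
    exact ((hMt (Sum.inr v) hut).2 v rfl b (hbt v hut)).2
  -- Step 3: W2's count
  obtain ⟨y, hyT, hyD, hyt, hy0⟩ := exists_ne_zero_levelTwoAuxiliary_deep W e hμ hadd₁ hadd₂ hgal halt hnondeg hΔ s D t hsD hst
    hDt hsK Mt (fun u hu ↦ (hMt u hu).1) hδ hbT hbS hbt' hb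
  refine ⟨y, hyT, hy0, hyD, fun v hvt Z hZ ↦ ?_⟩
  exact ((hMt (Sum.inr v) hvt).2 v rfl Z hZ).1 _ (hyt _ hvt)

end Auxiliary

/-! ## §2 The reciprocity with the shallow-, genus- and deep-terms in vanishing form (any number field, any level) -/

section Reciprocity

variable {K : Type} [Field K] [NumberField K] (W : WeierstrassCurve K) [W.IsElliptic]
variable (n : ℕ) [NeZero n]
variable (e : W.geomTorsion n → W.geomTorsion n → AlgebraicClosure K)
  (hμ : ∀ S T, e S T ^ n = 1)
  (hadd₁ : ∀ S₁ S₂ T, e (S₁ + S₂) T = e S₁ T * e S₂ T)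
  (hadd₂ : ∀ S T₁ T₂, e S (T₁ + T₂) = e S T₁ * e S T₂)
  (hgal : ∀ (σ : absoluteGaloisGroup K) (S T : W.geomTorsion n), σ • e S T = e (σ • S) (σ • T))
  (halt : ∀ T, e T T = 1)

include halt in
/-- **The reciprocity step of the level-2 engine.**  `s`, `D`, `t` pairwise disjoint, `l′ ∉ s ∪ D ∪ t`; `X`, `y` Kummer off
`{l′} ∪ s ∪ D ∪ t`; `loc_u X = 0` on `s`; `loc_u y = 0` on `D`; the local terms vanish on `t`.  Then the `l′`-term vanishes:
`inv_{l′}(loc_{l′} X ∪ₑ loc_{l′} y) = 0` (Poitou–Tate sum over the exceptional places). [cite: McCallumLMS1991, §5 proof of Prop. 5.2]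
[cite: MilneADT2006, Ch. I, Thm. 4.10] -/
theorem invWeilPairing_eq_zero_of_levelTwo_of_vanishing {inv : LocalInvariants K n} (hsum : inv.SumLocalTermEqZero)
    (s D t : Finset (Place K)) (l' : Place K) (hl's : l' ∉ s) (hl'D : l' ∉ D) (hl't : l' ∉ t) (hsD : Disjoint s D)
    (hst : Disjoint s t) (hDt : Disjoint D t)
    {X y : galoisCohomology (W.torsionGaloisModule (n : ℤ)) 1}
    (hX : X ∈ kummerOutside W n (insert l' (s ∪ D ∪ t))) (hy : y ∈ kummerOutside W n (insert l' (s ∪ D ∪ t)))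
    (hXs : ∀ u ∈ s, galoisCohomology.localization (W.torsionGaloisModule (n : ℤ)) u 1 X = 0)
    (hyD : ∀ u ∈ D, galoisCohomology.localization (W.torsionGaloisModule (n : ℤ)) u 1 y = 0)
    (ht : ∀ u ∈ t, invWeilPairing W n e hμ hadd₁ hadd₂ hgal inv u
      (galoisCohomology.localization (W.torsionGaloisModule (n : ℤ)) u 1 X)
      (galoisCohomology.localization (W.torsionGaloisModule (n : ℤ)) u 1 y) = 0) :
    invWeilPairing W n e hμ hadd₁ hadd₂ hgal inv l'
      (galoisCohomology.localization (W.torsionGaloisModule (n : ℤ)) l' 1 X)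
      (galoisCohomology.localization (W.torsionGaloisModule (n : ℤ)) l' 1 y) = 0 := by
  have hrec := sum_invWeilPairing_localization_eq_zero_of_mem_kummerOutside W n e hμ hadd₁ hadd₂ hgal halt inv hsum
    (insert l' (s ∪ D ∪ t)) hX hy
  have hl'sDt : l' ∉ s ∪ D ∪ t := fun h ↦ by
    rcases Finset.mem_union.mp h with h | h
    · rcases Finset.mem_union.mp h with h | h
      · exact hl's h
      · exact hl'D h
    · exact hl't h
  have hsDt : Disjoint (s ∪ D) t := Finset.disjoint_union_left.mpr ⟨hst, hDt⟩
  rw [Finset.sum_insert hl'sDt, Finset.sum_union hsDt, Finset.sum_union hsD] at hrec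
  have hs0 : ∑ u ∈ s, invWeilPairing W n e hμ hadd₁ hadd₂ hgal inv u
      (galoisCohomology.localization (W.torsionGaloisModule (n : ℤ)) u 1 X)
      (galoisCohomology.localization (W.torsionGaloisModule (n : ℤ)) u 1 y) = 0 :=
    Finset.sum_eq_zero fun u hu ↦ by rw [hXs u hu, map_zero, AddMonoidHom.zero_apply]
  have hD0 : ∑ u ∈ D, invWeilPairing W n e hμ hadd₁ hadd₂ hgal inv u
      (galoisCohomology.localization (W.torsionGaloisModule (n : ℤ)) u 1 X)
      (galoisCohomology.localization (W.torsionGaloisModule (n : ℤ)) u 1 y) = 0 :=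
    Finset.sum_eq_zero fun u hu ↦ by rw [hyD u hu, map_zero]
  have ht0 : ∑ u ∈ t, invWeilPairing W n e hμ hadd₁ hadd₂ hgal inv u
      (galoisCohomology.localization (W.torsionGaloisModule (n : ℤ)) u 1 X)
      (galoisCohomology.localization (W.torsionGaloisModule (n : ℤ)) u 1 y) = 0 :=
    Finset.sum_eq_zero fun u hu ↦ ht u hu
  rw [hs0, hD0, ht0, add_zero, add_zero, add_zero] at hrec
  exact hrec

end Reciprocity

/-! ## §3 The auxiliary AND the reciprocity: the `l′`-term vanishes for the class of §1 -/

section AuxiliaryRec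

variable (W : WeierstrassCurve ℚ) [W.IsElliptic] [W.IsGloballyMinimal]
variable (e : geomTorsion W ((2 ^ 1 : ℕ) : ℤ) → geomTorsion W ((2 ^ 1 : ℕ) : ℤ) → AlgebraicClosure ℚ)
  (hμ : ∀ S T, e S T ^ (2 ^ 1) = 1)
  (hadd₁ : ∀ S₁ S₂ T, e (S₁ + S₂) T = e S₁ T * e S₂ T)
  (hadd₂ : ∀ S T₁ T₂, e S (T₁ + T₂) = e S T₁ * e S T₂)
  (hgal : ∀ (σ : absoluteGaloisGroup ℚ) (S T : geomTorsion W ((2 ^ 1 : ℕ) : ℤ)), σ • e S T = e (σ • S) (σ • T))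
  (halt : ∀ T, e T T = 1) (hnondeg : ∀ T, (∀ S, e S T = 1) → T = 0)

include halt hnondeg in
/-- **Auxiliary + reciprocity for the level-2 engine, by name.**  Under the hypotheses of `exists_auxiliary_levelTwo`: there is
`y ≠ 0`, Kummer off `s ∪ D ∪ t`, ZERO on `D`, such that for EVERY further place `l′ ∉ s ∪ D ∪ t` and EVERY `Z ∈ H¹(ℚ, E[2])` Kummer off
`{l′} ∪ s ∪ D ∪ t` with `loc_u Z = 0` at the places of `s` and `Z` transverse at the places of `t`:
`inv_{l′}(loc_{l′} Z ∪ₑ loc_{l′} y) = 0` (canonical family). [cite: McCallumLMS1991, §5 proof of Prop. 5.2] [cite: MilneADT2006, Ch. I, Thm. 4.10] -/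
theorem exists_auxiliary_levelTwo_rec (hΔ : W.Δ < 0) {K : Type} [Field K] [NumberField K]
    (s D t : Finset (Place ℚ)) (hsD : Disjoint s D) (hst : Disjoint s t) (hDt : Disjoint D t)
    (hsK : ∀ u ∈ s ∪ t, ∃ (v : HeightOneSpectrum (𝓞 ℚ)) (ℓ : ℕ) (_ : Fact ℓ.Prime), u = Sum.inr v ∧ ℓ ≠ 2 ∧ (ℓ : 𝓞 ℚ) ∈ v.asIdeal ∧
      W.HasGoodReductionAtPrime ℓ ∧ FrobEqFrobInfty W K 2 ℓ ∧ 1 ≤ Zhang2014.kolyvaginIndex W 2 ℓ)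
    (hδ : ∏ u ∈ D, Nat.card (galoisCohomology ((W.torsionGaloisModule ((2 ^ 1 : ℕ) : ℤ)).toLocal u) 1) ≤ 4 ^ s.card)
    {b : galoisCohomology (W.torsionGaloisModule ((2 ^ 1 : ℕ) : ℤ)) 1} (hbT : b ∈ kummerOutside W (2 ^ 1) (s ∪ D ∪ t))
    (hbS : ∀ u ∈ s, galoisCohomology.localization (W.torsionGaloisModule ((2 ^ 1 : ℕ) : ℤ)) u 1 b = 0)
    (hbt : ∀ v : HeightOneSpectrum (𝓞 ℚ), Sum.inr v ∈ t →
      ∀ 𝔓 ∈ v.primesAbove, ∀ F c₀ : absoluteGaloisGroup ℚ, IsArithFrobAt (𝓞 ℚ) F 𝔓 →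
        IsComplexConjugation (Rat.castHom ℝ) c₀ → (∀ P : geomTorsion W ((2 ^ 1 : ℕ) : ℤ), F • P = c₀ • P) →
        ∃ P₁ : geomTorsion W ((2 ^ 1 : ℕ) : ℤ), h1Eval W _ b F = F • P₁ - P₁)
    (hb : b ≠ 0) :
    ∃ y ∈ kummerOutside W (2 ^ 1) (s ∪ D ∪ t), y ≠ 0 ∧
      (∀ u ∈ D, galoisCohomology.localization (W.torsionGaloisModule ((2 ^ 1 : ℕ) : ℤ)) u 1 y = 0) ∧
      ∀ l' : Place ℚ, l' ∉ s ∪ D ∪ t →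
        ∀ Z : galoisCohomology (W.torsionGaloisModule ((2 ^ 1 : ℕ) : ℤ)) 1,
          Z ∈ kummerOutside W (2 ^ 1) (insert l' (s ∪ D ∪ t)) →
          (∀ u ∈ s, galoisCohomology.localization (W.torsionGaloisModule ((2 ^ 1 : ℕ) : ℤ)) u 1 Z = 0) →
          (∀ v : HeightOneSpectrum (𝓞 ℚ), Sum.inr v ∈ t →
            ∀ 𝔓 ∈ v.primesAbove, ∀ F c₀ : absoluteGaloisGroup ℚ, IsArithFrobAt (𝓞 ℚ) F 𝔓 →
              IsComplexConjugation (Rat.castHom ℝ) c₀ → (∀ P : geomTorsion W ((2 ^ 1 : ℕ) : ℤ), F • P = c₀ • P) →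
              ∃ P₁ : geomTorsion W ((2 ^ 1 : ℕ) : ℤ), h1Eval W _ Z F = F • P₁ - P₁) →
          invWeilPairing W (2 ^ 1) e hμ hadd₁ hadd₂ hgal (LocalInvariants.canonical ℚ (2 ^ 1)) l'
            (galoisCohomology.localization (W.torsionGaloisModule ((2 ^ 1 : ℕ) : ℤ)) l' 1 Z)
            (galoisCohomology.localization (W.torsionGaloisModule ((2 ^ 1 : ℕ) : ℤ)) l' 1 y) = 0 := by
  haveI : NeZero (2 ^ 1) := ⟨by norm_num⟩
  have hsum := sumLocalTermEqZero_canonical (K := ℚ) (2 ^ 1)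
  obtain ⟨y, hyKO, hy0, hyD, hdeep⟩ := exists_auxiliary_levelTwo W e hμ hadd₁ hadd₂ hgal halt hnondeg hΔ s D t hsD hst hDt hsK hδ
    hbT hbS hbt hb
  refine ⟨y, hyKO, hy0, hyD, fun l' hl' Z hX hXs hZt ↦ ?_⟩
  have hl's : l' ∉ s := fun h ↦ hl' (Finset.mem_union_left t (Finset.mem_union_left D h))
  have hl'D : l' ∉ D := fun h ↦ hl' (Finset.mem_union_left t (Finset.mem_union_right s h))
  have hl't : l' ∉ t := fun h ↦ hl' (Finset.mem_union_right _ h)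
  have hy' : y ∈ kummerOutside W (2 ^ 1) (insert l' (s ∪ D ∪ t)) :=
    kummerOutside_mono W (2 ^ 1) (Finset.subset_insert l' (s ∪ D ∪ t)) hyKO
  refine invWeilPairing_eq_zero_of_levelTwo_of_vanishing W (2 ^ 1) e hμ hadd₁ hadd₂ hgal halt hsum s D t l' hl's hl'D hl't hsD
    hst hDt hX hy' hXs hyD fun u hu ↦ ?_
  obtain ⟨v, ℓ, hℓp, huv, -⟩ := hsK u (Finset.mem_union_right s hu)
  subst huv
  exact hdeep v hu Z (hZt v hu)

end AuxiliaryRec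

end Summit.BirchSwinnertonDyer.BirchSwinnertonDyer.Theorems.KolyvaginLowerTwo

end
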